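import Literature.MathematicalPhysics.QuantumFieldTheory.Balaban1983to89.Node00.Record13SepCoPH
import Literature.MathematicalPhysics.QuantumFieldTheory.Balaban1983to89.Node00.Record12BgRowHistory

/-!
# BalabanUVNodes ∕ N13 — THE (UV₁₃) ROW WITH DEPTH-INDEXED CONSTANTS: in the window with the WORLD's positive lower β-box, asymptotic freedom
# bounds the REMAINING DEPTH `K − k` by `g_k⁻²∕b`, so [III] Cor. 3's «E± depending on g_k» at the record follows from two-sided bounds whose
# constants depend on the coupling value AND the remaining depth (equivalently on the volume `|T₁^{(k)}| = (2L^{m+K−k})⁴`)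

Cell `pub-ymgap` (HUMAN RULING D-0062 Track A; D-0149 width seat `pub-ymgap-dag-n13-w1`, g3, CLAIM-1), key K1⁷ `StabilityBAtRecordR13SepCoPH` = stmt-QuantumFields-20542
(`--kind proof --supports … --as helper`).  [III] = [Balaban1988Convergent], [B16] = [Balaban1989LargeFieldII], [I] = [Balaban1987RG1].

WHY THIS FILE.  N13's (UV₁₃) row — the `hUV` binder of dag-n12-d's S-bound four-pin engine `nodes₁₃CoPH_upS_fourPinW₀_pointed` ∕ dag-n24-c's K1⁷ closers, i.e. the Cor.-3
conjunct `B16.Cor3With (datumOfRecord₁₃SepCoPH θ h).C γ em ep` of K1⁷'s (B) — asks for the two-sided bound (0.1) ∕ (2.50)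
`χ_k·exp(−g_k⁻²A − em(g_k)|T₁^{(k)}|) ≤ ρ_k ≤ exp(ep(g_k)|T₁^{(k)}|)` with dependence FUNCTIONS `em, ep` of the running coupling ALONE ([III] Cor. 3 p. 264:
«constants E₋, E₊ independent of η and T, but depending on g_k»).  The same K1⁷ world carries NODE O's positive lower β-box `hlo : BetaLowerH w.b w.γ β₁₃(θ)`,
`0 < w.b` (`DagBinding.WorldP.b_pos`; Part 14's door ∕ `N24K1ConsequentOfStubsV19AndChildren`'s `hchildren`).  ELEMENTARY CONSEQUENCE OF (0.20) typed here: along a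
windowed run `g_{j+1}⁻² = g_j⁻² − β_j(g₀,…,g_j) ≤ g_j⁻² − b` (`Node00.inv_sq_genSeq_succ`), hence `(K − k)·b < g_k⁻²` — AT A GIVEN COUPLING VALUE ONLY FINITELY MANY
REMAINING DEPTHS OCCUR.  So: (i) the volume of the level-`k` unit lattice of the datum of record is bounded by a function of `g_k`, `|T₁^{(k)}| ≤ (2L^{m+⌊g_k⁻²∕b⌋})⁴`
(the `|T_η|` of (2.50) is DECORATIVE in the typed finite-volume reading: what survives of the printed clause is uniformity in the number `k` of completed steps at
bounded remaining depth); (ii) SUPPLIER-SIDE RELAXATION — a family of two-sided bounds whose constants `Em(g_k, K−k)`, `Ep(g_k, K−k)` depend on the coupling value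
AND the remaining depth (equivalently on `|T₁^{(k)}|`) already yields `Cor3With … γ em ep` ∕ the engines' `hUV` with `em, ep` functions of `g_k` alone (a finite
maximum dominates: `exists_dominating_of_depthBound`).  Companion of the audit cell's K-CEILING under coupling-UNIFORM constants (`B16B10Shape` §3,
`B16SmallCouplings`): the g_k-dependent reading bounds `K − k` instead of `K`.

WHAT THIS FILE PROVES (theorems only, 0 `def`):
§1 (generic `β : HBeta`, window `Step.InInterval γ K (genSeq β g₀)`, `BetaLowerH b γ β`): `inv_sq_genSeq_add_mul_le_of_betaLowerH` (`(g_{k+d}²)⁻¹ + d·b ≤ (g_k²)⁻¹`),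
   ★ `remainingSteps_mul_lt_inv_sq_of_betaLowerH` (`(K−k)·b < (g_k²)⁻¹`), `remainingSteps_lt_of_betaLowerH`, `remainingSteps_le_floor_of_betaLowerH`.
§2 (generic `C : B16.Construction`): `exists_dominating_of_depthBound`, ★ `cor3With_of_depthIndexed`, `cor3_250_of_depthIndexed`.
§3 (the record, `θ : Stage13HParams F N`, `h : θ.Provisos₁₃SepCoPH F N`, N-generic): `remainingSteps_mul_lt_inv_sq_datumOfRecord₁₃SepCoPH`,
   ★ `numSites_datumOfRecord₁₃SepCoPH_le_of_betaLowerH`, ★★ `cor3With_datumOfRecord₁₃SepCoPH_of_depthIndexed`, `cor3_250_datumOfRecord₁₃SepCoPH_of_depthIndexed`,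
   `cor3_250_datumOfRecord₁₃SepCoPH_of_volumeIndexed`, ★★ `hUV₁₃_of_depthIndexed` (the engines' binder verbatim), and the located converse
   `volumeFree_of_cor3With_datumOfRecord₁₃SepCoPH` (`Cor3With` + `b > 0` ⇒ `|T|`-free coupling-indexed bounds).

HONEST FRAMING.  Count-neutral reading ∕ supplier-shape bookkeeping (elementary real analysis on (0.20) + the torus count); the positive lower β-box `b > 0` is NODE O's
unprinted input (the DAG's leaf `betaPositive`, T09.F; [I] p. 264 defers «other properties» of the β-functions) — DISPLAYED, never asserted; nothing of Bałaban's
asserted; the content of (U)∕(L) — dag-n13-w3's leaves U1∕U2∕L2 — is NOT supplied; N13 NOT discharged; K0⁷∕K1⁷ NOT closed; counts unmoved (5∕27 · A 5∕28); one finite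
`𝕋⁴_{L^K}` programme at fixed `ε = L^{−K}` — R4 closes the conditional finite-𝕋⁴ rung `BalabanLadder.UV` only; the YM mass gap (Clay) is NOT proved by any of this.
No `def`, no `sorry`, no `instance`, no `notation`.
-/

noncomputable section

open scoped Matrix.Norms.L2Operator

namespace Summit.QuantumFields.YangMills.BalabanUVNodes.N13UVRowDepthIndexedAtRecord13

open Literature.MathematicalPhysics.QuantumFieldTheory.Balaban1983to89
open Literature.MathematicalPhysics.QuantumFieldTheory.Balaban1983to89.T4Continuum (T4Family)
open Literature.MathematicalPhysics.QuantumFieldTheory.Balaban1983to89.Node00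
open FlowStep (HBeta prefixOf Box mem_box BetaLowerH)
open FlowStepRuns (genSeq genFlow)
open DagBinding (WorldP)

/-! ## §1 The coupling flow under a LOWER β-box in the window: the remaining depth is bounded by `g_k⁻²∕b` -/

section Flow

variable (β : HBeta) (g0 : ℝ) {γ b : ℝ} {K : ℕ}

/-- **`(g_{k+d}²)⁻¹ + d·b ≤ (g_k²)⁻¹` ALONG A WINDOWED HISTORY WITH `β ≥ b` ON THE γ-BOX** (`k + d ≤ K`): (0.20) `g_{j+1}⁻² = g_j⁻² − β_j(g₀,…,g_j)`
(`Node00.inv_sq_genSeq_succ`) iterated `d` times; each step loses at least `b`.  No sign of `b` is used. [cite: Balaban1987RG1, (0.18)–(0.20) pp.255–256, §1 p.264 (bookkeeping); Balaban1988Convergent, (2.6) p.255] -/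
theorem inv_sq_genSeq_add_mul_le_of_betaLowerH (hβ : BetaLowerH b γ β) (hI : Step.InInterval γ K (genSeq β g0)) (k : ℕ) :
    ∀ d : ℕ, k + d ≤ K → ((genSeq β g0 (k + d)) ^ 2)⁻¹ + (d : ℝ) * b ≤ ((genSeq β g0 k) ^ 2)⁻¹
  | 0, _ => by simp
  | d + 1, hd => by
    have hprev := inv_sq_genSeq_add_mul_le_of_betaLowerH hβ hI k d (by omega)
    have hpos : 0 < genSeq β g0 (k + d + 1) := (hI (k + d + 1) hd).1
    have hstep := inv_sq_genSeq_succ β g0 hpos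
    have hbox : prefixOf (genSeq β g0) (k + d) ∈ Box γ (k + d) :=
      mem_box.mpr fun i => hI i (by have := i.isLt; omega)
    have hb : b ≤ β (k + d) (prefixOf (genSeq β g0) (k + d)) := hβ (k + d) _ hbox
    have hkd : k + (d + 1) = k + d + 1 := rfl
    rw [hkd, hstep]
    push_cast
    linarith

/-- **★ THE REMAINING DEPTH IS BOUNDED BY THE COUPLING: `(K − k)·b < (g_k²)⁻¹`** along a windowed history (`0 < g_j ≤ γ`, `j ≤ K`) with `β ≥ b` on the γ-box, for every
`k ≤ K` — because `(g_K²)⁻¹ > 0` is what is left after `K − k` losses of at least `b`.  With `b > 0` this is (discrete) asymptotic freedom read backwards: at a given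
value of the running coupling only finitely many further steps fit in the window. [cite: Balaban1987RG1, (0.20) p.256, Thm 2 (0.31) p.259 (bookkeeping)] -/
theorem remainingSteps_mul_lt_inv_sq_of_betaLowerH (hβ : BetaLowerH b γ β) (hI : Step.InInterval γ K (genSeq β g0)) {k : ℕ} (hk : k ≤ K) :
    ((K - k : ℕ) : ℝ) * b < ((genSeq β g0 k) ^ 2)⁻¹ := by
  have h := inv_sq_genSeq_add_mul_le_of_betaLowerH β g0 hβ hI k (K - k) (by omega)
  rw [show k + (K - k) = K by omega] at h
  have hpos : 0 < ((genSeq β g0 K) ^ 2)⁻¹ := by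
    have := (hI K le_rfl).1
    positivity
  linarith

/-- `b > 0` form: `K − k < g_k⁻²∕b`. [cite: Balaban1987RG1, (0.20) p.256, Thm 2 (0.31) p.259 (bookkeeping)] -/
theorem remainingSteps_lt_of_betaLowerH (hb : 0 < b) (hβ : BetaLowerH b γ β) (hI : Step.InInterval γ K (genSeq β g0)) {k : ℕ} (hk : k ≤ K) :
    ((K - k : ℕ) : ℝ) < ((genSeq β g0 k) ^ 2)⁻¹ / b :=
  (lt_div_iff₀ hb).mpr (remainingSteps_mul_lt_inv_sq_of_betaLowerH β g0 hβ hI hk)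

/-- `b > 0`, integer form: `K − k ≤ ⌊g_k⁻²∕b⌋₊`. [cite: Balaban1987RG1, (0.20) p.256, Thm 2 (0.31) p.259 (bookkeeping)] -/
theorem remainingSteps_le_floor_of_betaLowerH (hb : 0 < b) (hβ : BetaLowerH b γ β) (hI : Step.InInterval γ K (genSeq β g0)) {k : ℕ} (hk : k ≤ K) :
    K - k ≤ ⌊((genSeq β g0 k) ^ 2)⁻¹ / b⌋₊ :=
  Nat.le_floor (remainingSteps_lt_of_betaLowerH β g0 hb hβ hI hk).le

end Flow

/-! ## §2 Generic constructions: depth-indexed two-sided bounds ⇒ `Cor3With` with coupling-indexed functions -/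

section Generic

variable (C : B16.Construction)

/-- **FINITE-MAX DOMINATION**: for `b > 0` and ANY family `E : ℝ → ℕ → ℝ` there is ONE function `e` of the coupling with `E x n ≤ e x` whenever `n·b < (x²)⁻¹` — at a given `x`
only the finitely many `n ≤ ⌊(x²)⁻¹∕b⌋` qualify (`e x := max_{n ≤ ⌊(x²)⁻¹∕b⌋} E x n`).  Elementary. [cite: Balaban1988Convergent, Cor. 3 (2.50) p.264 («depending on g_k»; bookkeeping)] -/
theorem exists_dominating_of_depthBound {b : ℝ} (hb : 0 < b) (E : ℝ → ℕ → ℝ) :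
    ∃ e : ℝ → ℝ, ∀ x : ℝ, 0 < x → ∀ n : ℕ, (n : ℝ) * b < (x ^ 2)⁻¹ → E x n ≤ e x := by
  classical
  refine ⟨fun x => (Finset.range (⌊(x ^ 2)⁻¹ / b⌋₊ + 1)).sup' ⟨0, by simp⟩ (E x), fun x _ n hn => ?_⟩
  have hn' : n ≤ ⌊(x ^ 2)⁻¹ / b⌋₊ := Nat.le_floor ((le_div_iff₀ hb).mpr hn.le)
  exact Finset.le_sup' (E x) (Finset.mem_range.mpr (Nat.lt_succ_of_le hn'))

/-- **★ `Cor3With` FROM DEPTH-INDEXED TWO-SIDED BOUNDS.**  If along every windowed run the remaining depth obeys `(K − k)·b < (g_k²)⁻¹` (§1 under a lower β-box), the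
construction obeys the sign convention `χ_k ≥ 0`, and (0.1) holds at every `(P, k ≤ K, V)` with constants `Em(g_k, K−k)`, `Ep(g_k, K−k)` — functions of the coupling
value AND the remaining depth — then `B16.Cor3With C γ em ep` holds for ANY `em, ep : ℝ → ℝ` dominating them on the qualifying depths (`n·b < (x²)⁻¹ ⇒ E x n ≤ e x`;
such functions exist, `exists_dominating_of_depthBound`).  Monotonicity of (0.1) in its two constants = `B16.uvIneq_of_le`. [cite: Balaban1988Convergent, Cor. 3 (2.50) p.264; Balaban1989LargeFieldII, (0.1) pp.355–356] -/
theorem cor3With_of_depthIndexed (γ b : ℝ) (hsign : B16.SignConventions C)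
    (hdepth : ∀ P : B12.RunParams, (C P).flow.InInterval γ P.K → ∀ k, k ≤ P.K → ((P.K - k : ℕ) : ℝ) * b < (((C P).flow.g k) ^ 2)⁻¹)
    (Em Ep : ℝ → ℕ → ℝ) (em ep : ℝ → ℝ)
    (hem : ∀ x : ℝ, 0 < x → ∀ n : ℕ, (n : ℝ) * b < (x ^ 2)⁻¹ → Em x n ≤ em x)
    (hep : ∀ x : ℝ, 0 < x → ∀ n : ℕ, (n : ℝ) * b < (x ^ 2)⁻¹ → Ep x n ≤ ep x)
    (hUV : ∀ P : B12.RunParams, (C P).flow.InInterval γ P.K → ∀ k, k ≤ P.K → ∀ V : (C P).Cfg k,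
      B16.UVIneq (C P) k V (Em ((C P).flow.g k) (P.K - k)) (Ep ((C P).flow.g k) (P.K - k))) :
    B16.Cor3With C γ em ep := fun P hP k hk V =>
  B16.uvIneq_of_le (C P) k V (hsign P k V) (hUV P hP k hk V)
    (hem _ (hP k hk).1 _ (hdepth P hP k hk)) (hep _ (hP k hk).1 _ (hdepth P hP k hk))

/-- **`Cor3_250` FROM A DEPTH-INDEXED FAMILY** (`b > 0`, `γ > 0`): the dominating functions are produced by `exists_dominating_of_depthBound`.
[cite: Balaban1988Convergent, Cor. 3 (2.50) p.264; Balaban1989LargeFieldII, (0.1) pp.355–356] -/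
theorem cor3_250_of_depthIndexed {γ b : ℝ} (hγ : 0 < γ) (hb : 0 < b) (hsign : B16.SignConventions C)
    (hdepth : ∀ P : B12.RunParams, (C P).flow.InInterval γ P.K → ∀ k, k ≤ P.K → ((P.K - k : ℕ) : ℝ) * b < (((C P).flow.g k) ^ 2)⁻¹)
    (Em Ep : ℝ → ℕ → ℝ)
    (hUV : ∀ P : B12.RunParams, (C P).flow.InInterval γ P.K → ∀ k, k ≤ P.K → ∀ V : (C P).Cfg k,
      B16.UVIneq (C P) k V (Em ((C P).flow.g k) (P.K - k)) (Ep ((C P).flow.g k) (P.K - k))) :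
    B16.Cor3_250 C := by
  obtain ⟨em, hem⟩ := exists_dominating_of_depthBound hb Em
  obtain ⟨ep, hep⟩ := exists_dominating_of_depthBound hb Ep
  exact ⟨γ, hγ, em, ep, cor3With_of_depthIndexed C γ b hsign hdepth Em Ep em ep hem hep hUV⟩

end Generic

/-! ## §3 At NODE 00's Stage-13 datum of record `datumOfRecord₁₃SepCoPH F N θ h` -/

section Record

variable {F : T4Family} {N : ℕ} [NeZero N] (θ : Stage13HParams F N) (h : θ.Provisos₁₃SepCoPH F N)

/-- **THE REMAINING DEPTH OF A WINDOWED RUN OF THE DATUM OF RECORD IS BOUNDED BY ITS COUPLING**: `(K − k)·b < (g_k²)⁻¹` for `k ≤ K`, whenever the β of record obeys the lower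
box `BetaLowerH b γ β₁₃(θ)` and the run's couplings `g_j = genSeq β₁₃(θ) g₀ j` stay in `]0, γ]` for `j ≤ K` (the datum's flow IS that history, `Node00.flow_g_datumOfRecord₁₃SepCoPH`).
[cite: Balaban1987RG1, (0.20) p.256, Thm 2 (0.31) p.259 (bookkeeping)] -/
theorem remainingSteps_mul_lt_inv_sq_datumOfRecord₁₃SepCoPH {γ b : ℝ} (hβ : BetaLowerH b γ (betaOfRecord₁₃ F N θ.toStage13Params))
    (P : B12.RunParams) (hP : ((datumOfRecord₁₃SepCoPH F N θ h).C P).flow.InInterval γ P.K) {k : ℕ} (hk : k ≤ P.K) :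
    ((P.K - k : ℕ) : ℝ) * b < ((gOfRecord₁₃ F N θ.toStage13Params P k) ^ 2)⁻¹ :=
  remainingSteps_mul_lt_inv_sq_of_betaLowerH (betaOfRecord₁₃ F N θ.toStage13Params) P.g0 hβ (fun j hj => hP j hj) hk

/-- **★ THE VOLUME OF (2.50) IS BOUNDED BY THE COUPLING** (`b > 0`): along a windowed run of the datum of record, `|T₁^{(k)}| ≤ (2·L^{m+⌊(g_k²)⁻¹∕b⌋})⁴` for `k ≤ K` — so in the typed
finite-volume reading of [III] Cor. 3 («depending on g_k») the factor `|T_η|` is dominated by a function of `g_k`; what the printed clause retains is uniformity in the number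
`k` of completed steps at bounded remaining depth.  LOCATED reading, not a flag. [cite: Balaban1988Convergent, Cor. 3 (2.50) p.264; Balaban1987RG1, (0.1) p.251, (0.20) p.256 (bookkeeping)] -/
theorem numSites_datumOfRecord₁₃SepCoPH_le_of_betaLowerH {γ b : ℝ} (hb : 0 < b) (hβ : BetaLowerH b γ (betaOfRecord₁₃ F N θ.toStage13Params))
    (P : B12.RunParams) (hP : ((datumOfRecord₁₃SepCoPH F N θ h).C P).flow.InInterval γ P.K) {k : ℕ} (hk : k ≤ P.K) :
    ((datumOfRecord₁₃SepCoPH F N θ h).C P).numSites k ≤ (2 * F.L ^ (F.m + ⌊((gOfRecord₁₃ F N θ.toStage13Params P k) ^ 2)⁻¹ / b⌋₊)) ^ 4 := by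
  -- the site count of the datum of record: `|T₁^{(k)}| = (2·L^{m+K−k})⁴` (def-T's `datumOfTower` ∕ `Site.card_site` ∕ `Params.sitesPerDir`; dag-n13-w3's
  -- `…N13UV01SignAtRecord13SepCoPH.numSites_datumOfRecord₁₃SepCoPH` states it inside the theses cone — recomputed inline here to stay outside it)
  have hnum : ((datumOfRecord₁₃SepCoPH F N θ h).C P).numSites k = (2 * F.L ^ (F.m + P.K - k)) ^ 4 := by
    show Fintype.card (Site (F.P P.K) k) = _
    rw [Site.card_site]
    rfl
  have hKk : P.K - k ≤ ⌊((gOfRecord₁₃ F N θ.toStage13Params P k) ^ 2)⁻¹ / b⌋₊ :=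
    remainingSteps_le_floor_of_betaLowerH (betaOfRecord₁₃ F N θ.toStage13Params) P.g0 hb hβ (fun j hj => hP j hj) hk
  have hL : 1 ≤ F.L := F.hL.2.le
  have hmk : F.m + P.K - k = F.m + (P.K - k) := by omega
  rw [hnum, hmk]
  gcongr

/-- **★★ K1⁷'s COR.-3 CONJUNCT AT THE RECORD FROM DEPTH-INDEXED TWO-SIDED BOUNDS** — `B16.Cor3With (datumOfRecord₁₃SepCoPH θ h).C γ em ep` from: the lower β-box
`BetaLowerH b γ β₁₃(θ)` (NODE O's `0 < w.b` letter; `b > 0` is used only through the domination hypotheses), (0.1) at every windowed `(P, k ≤ K, V)` with constants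
`Em(g_k, K−k)`, `Ep(g_k, K−k)`, and any `em, ep` dominating them on the qualifying depths.  The sign convention at the record is K0e's `chiFix29OfRecord_mem_Icc` (dag-n13-w3's `signConventions_datumOfRecord₁₃SepCoPH`, not imported: theses cone).
[cite: Balaban1988Convergent, Cor. 3 (2.50) p.264; Balaban1989LargeFieldII, (0.1) pp.355–356; Balaban1987RG1, (0.20) p.256, (2.9) p.266] -/
theorem cor3With_datumOfRecord₁₃SepCoPH_of_depthIndexed {γ b : ℝ} (hβ : BetaLowerH b γ (betaOfRecord₁₃ F N θ.toStage13Params))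
    (Em Ep : ℝ → ℕ → ℝ) (em ep : ℝ → ℝ)
    (hem : ∀ x : ℝ, 0 < x → ∀ n : ℕ, (n : ℝ) * b < (x ^ 2)⁻¹ → Em x n ≤ em x)
    (hep : ∀ x : ℝ, 0 < x → ∀ n : ℕ, (n : ℝ) * b < (x ^ 2)⁻¹ → Ep x n ≤ ep x)
    (hUV : ∀ P : B12.RunParams, ((datumOfRecord₁₃SepCoPH F N θ h).C P).flow.InInterval γ P.K → ∀ k, k ≤ P.K → ∀ V : GaugeField (F.P P.K) k (SU N),
      B16.UVIneq ((datumOfRecord₁₃SepCoPH F N θ h).C P) k V (Em (gOfRecord₁₃ F N θ.toStage13Params P k) (P.K - k))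
        (Ep (gOfRecord₁₃ F N θ.toStage13Params P k) (P.K - k))) :
    B16.Cor3With (datumOfRecord₁₃SepCoPH F N θ h).C γ em ep :=
  cor3With_of_depthIndexed _ γ b (fun P k V => (chiFix29OfRecord_mem_Icc θ.ν θ.ε₂₉ P.K k V).1)
    (fun P hP _ hk => remainingSteps_mul_lt_inv_sq_datumOfRecord₁₃SepCoPH θ h hβ P hP hk) Em Ep em ep hem hep hUV

/-- **`Cor3_250` AT THE RECORD FROM A DEPTH-INDEXED FAMILY** (`γ > 0`, `b > 0`): the conjunct `B16.Cor3_250 (datumOfRecord₁₃SepCoPH θ h).C` of K1⁷'s (B).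
[cite: Balaban1988Convergent, Cor. 3 (2.50) p.264; Balaban1989LargeFieldII, (0.1) pp.355–356, p.391] -/
theorem cor3_250_datumOfRecord₁₃SepCoPH_of_depthIndexed {γ b : ℝ} (hγ : 0 < γ) (hb : 0 < b) (hβ : BetaLowerH b γ (betaOfRecord₁₃ F N θ.toStage13Params))
    (Em Ep : ℝ → ℕ → ℝ)
    (hUV : ∀ P : B12.RunParams, ((datumOfRecord₁₃SepCoPH F N θ h).C P).flow.InInterval γ P.K → ∀ k, k ≤ P.K → ∀ V : GaugeField (F.P P.K) k (SU N),
      B16.UVIneq ((datumOfRecord₁₃SepCoPH F N θ h).C P) k V (Em (gOfRecord₁₃ F N θ.toStage13Params P k) (P.K - k))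
        (Ep (gOfRecord₁₃ F N θ.toStage13Params P k) (P.K - k))) :
    B16.Cor3_250 (datumOfRecord₁₃SepCoPH F N θ h).C :=
  cor3_250_of_depthIndexed _ hγ hb (fun P k V => (chiFix29OfRecord_mem_Icc θ.ν θ.ε₂₉ P.K k V).1)
    (fun P hP _ hk => remainingSteps_mul_lt_inv_sq_datumOfRecord₁₃SepCoPH θ h hβ P hP hk) Em Ep hUV

/-- **VOLUME-INDEXED CONSTANTS** (`γ > 0`, `b > 0`): (0.1) at every windowed `(P, k ≤ K, V)` with constants `Em(g_k, |T₁^{(k)}|)`, `Ep(g_k, |T₁^{(k)}|)` — ANY dependence on the volume —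
gives `Cor3_250` at the record, because `|T₁^{(k)}| = (2L^{m+K−k})⁴` is a function of the remaining depth. [cite: Balaban1988Convergent, Cor. 3 (2.50) p.264; Balaban1989LargeFieldII, (0.1) pp.355–356; Balaban1987RG1, (0.1) p.251] -/
theorem cor3_250_datumOfRecord₁₃SepCoPH_of_volumeIndexed {γ b : ℝ} (hγ : 0 < γ) (hb : 0 < b) (hβ : BetaLowerH b γ (betaOfRecord₁₃ F N θ.toStage13Params))
    (Em Ep : ℝ → ℕ → ℝ)
    (hUV : ∀ P : B12.RunParams, ((datumOfRecord₁₃SepCoPH F N θ h).C P).flow.InInterval γ P.K → ∀ k, k ≤ P.K → ∀ V : GaugeField (F.P P.K) k (SU N),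
      B16.UVIneq ((datumOfRecord₁₃SepCoPH F N θ h).C P) k V
        (Em (gOfRecord₁₃ F N θ.toStage13Params P k) (((datumOfRecord₁₃SepCoPH F N θ h).C P).numSites k))
        (Ep (gOfRecord₁₃ F N θ.toStage13Params P k) (((datumOfRecord₁₃SepCoPH F N θ h).C P).numSites k))) :
    B16.Cor3_250 (datumOfRecord₁₃SepCoPH F N θ h).C := by
  refine cor3_250_datumOfRecord₁₃SepCoPH_of_depthIndexed θ h hγ hb hβ (fun x n => Em x ((2 * F.L ^ (F.m + n)) ^ 4))
    (fun x n => Ep x ((2 * F.L ^ (F.m + n)) ^ 4)) fun P hP k hk V => ?_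
  have hmk : F.m + P.K - k = F.m + (P.K - k) := by omega
  have hnum : ((datumOfRecord₁₃SepCoPH F N θ h).C P).numSites k = (2 * F.L ^ (F.m + (P.K - k))) ^ 4 := by
    rw [← hmk]
    show Fintype.card (Site (F.P P.K) k) = _
    rw [Site.card_site]
    rfl
  simpa only [hnum] using hUV P hP k hk V

/-- **★★ THE ENGINES' `hUV` BINDER, VERBATIM, FROM DEPTH-INDEXED TWO-SIDED BOUNDS** — at `θ.toStage13Params` of a v1.7 parameter, in the four-pin world `w : WorldP` of dag-n12-d's
`nodes₁₃CoPH_upS_fourPinW₀_pointed` ∕ dag-n24-c's K1⁷ closers: given the WORLD's lower β-box `BetaLowerH w.b w.γ β₁₃(θ)` (`0 < w.b` is a field of `WorldP`; the same `hlo`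
the closers display), a family of two-sided bounds guarded exactly like `hUV` (window + `SLaw₁₃CoPH`) but with constants `Em(g_k, K−k)`, `Ep(g_k, K−k)`, and the dominations
`Em x n ≤ w.em x`, `Ep x n ≤ w.ep x` on the qualifying depths `n·w.b < (x²)⁻¹`, the conclusion IS the engines' `hUV` hypothesis LETTER FOR LETTER (`χβ ≥ 0`:
K0e's `chiFix29OfRecord_mem_Icc`). [cite: Balaban1989LargeFieldII, Thm 1 p.355, (0.1) pp.355–356; Balaban1988Convergent, Cor. 3 (2.50) p.264; Balaban1987RG1, (0.20) p.256, (2.9) p.266] -/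
theorem hUV₁₃_of_depthIndexed (w : WorldP) (hlo : BetaLowerH w.b w.γ (betaOfRecord₁₃ F N θ.toStage13Params)) (Em Ep : ℝ → ℕ → ℝ)
    (hem : ∀ x : ℝ, 0 < x → ∀ n : ℕ, (n : ℝ) * w.b < (x ^ 2)⁻¹ → Em x n ≤ w.em x)
    (hep : ∀ x : ℝ, 0 < x → ∀ n : ℕ, (n : ℝ) * w.b < (x ^ 2)⁻¹ → Ep x n ≤ w.ep x)
    (hUVd : ∀ P : B12.RunParams, (genFlow (betaOfRecord₁₃ F N θ.toStage13Params) P.g0).InInterval w.γ P.K → ∀ k, k ≤ P.K → SLaw₁₃CoPH F N θ P k →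
      ∀ U : GaugeField (F.P P.K) k (SU N),
        chiβOfRecord₁₃ F N θ.toStage13Params P.K (gOfRecord₁₃ F N θ.toStage13Params P) k U *
              Real.exp (-(1 / (gOfRecord₁₃ F N θ.toStage13Params P k) ^ 2 * wilsonBGOfRecord F N θ.toStage13Params.εbg P k U)
                - Em (gOfRecord₁₃ F N θ.toStage13Params P k) (P.K - k) * (Fintype.card (Site (F.P P.K) k) : ℝ)) ≤ densOfRecord₁₃ F N θ.toStage13Params P k U ∧
        densOfRecord₁₃ F N θ.toStage13Params P k U ≤
          Real.exp (Ep (gOfRecord₁₃ F N θ.toStage13Params P k) (P.K - k) * (Fintype.card (Site (F.P P.K) k) : ℝ))) :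
    ∀ P : B12.RunParams, (genFlow (betaOfRecord₁₃ F N θ.toStage13Params) P.g0).InInterval w.γ P.K → ∀ k, k ≤ P.K → SLaw₁₃CoPH F N θ P k →
      ∀ U : GaugeField (F.P P.K) k (SU N),
        chiβOfRecord₁₃ F N θ.toStage13Params P.K (gOfRecord₁₃ F N θ.toStage13Params P) k U *
              Real.exp (-(1 / (gOfRecord₁₃ F N θ.toStage13Params P k) ^ 2 * wilsonBGOfRecord F N θ.toStage13Params.εbg P k U)
                - w.em (gOfRecord₁₃ F N θ.toStage13Params P k) * (Fintype.card (Site (F.P P.K) k) : ℝ)) ≤ densOfRecord₁₃ F N θ.toStage13Params P k U ∧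
        densOfRecord₁₃ F N θ.toStage13Params P k U ≤ Real.exp (w.ep (gOfRecord₁₃ F N θ.toStage13Params P k) * (Fintype.card (Site (F.P P.K) k) : ℝ)) := by
  intro P hP k hk hS U
  obtain ⟨hlow, hup⟩ := hUVd P hP k hk hS U
  have hg : 0 < gOfRecord₁₃ F N θ.toStage13Params P k := (hP k hk).1
  have hd : ((P.K - k : ℕ) : ℝ) * w.b < ((gOfRecord₁₃ F N θ.toStage13Params P k) ^ 2)⁻¹ :=
    remainingSteps_mul_lt_inv_sq_of_betaLowerH (betaOfRecord₁₃ F N θ.toStage13Params) P.g0 hlo (fun j hj => hP j hj) hk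
  have hχ : 0 ≤ chiβOfRecord₁₃ F N θ.toStage13Params P.K (gOfRecord₁₃ F N θ.toStage13Params P) k U :=
    (chiFix29OfRecord_mem_Icc θ.ν θ.ε₂₉ P.K k U).1
  have hT : (0 : ℝ) ≤ (Fintype.card (Site (F.P P.K) k) : ℝ) := Nat.cast_nonneg _
  have hm := mul_le_mul_of_nonneg_right (hem _ hg _ hd) hT
  have hp := mul_le_mul_of_nonneg_right (hep _ hg _ hd) hT
  refine ⟨le_trans (mul_le_mul_of_nonneg_left (Real.exp_le_exp.mpr (by linarith)) hχ) hlow, hup.trans (Real.exp_le_exp.mpr hp)⟩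

/-- **LOCATED CONVERSE — `Cor3With` AT THE RECORD IS VOLUME-FREE** (`b > 0`): from `B16.Cor3With (datumOfRecord₁₃SepCoPH θ h).C γ em ep` and the lower β-box, the two-sided bound
holds at every windowed `(P, k ≤ K, V)` with `|T₁^{(k)}|`-FREE constants depending on `g_k` alone: `χ_k·exp(−g_k⁻²A − f₋(g_k)) ≤ ρ_k ≤ exp(f₊(g_k))` with
`f±(x) := max(e±(x), 0)·(2L^{m+⌊(x²)⁻¹∕b⌋})⁴`.  Nothing is lost or gained: K1⁷'s Cor-3 conjunct and its volume-free form are the same demand under NODE O's `b > 0`.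
[cite: Balaban1988Convergent, Cor. 3 (2.50) p.264; Balaban1989LargeFieldII, (0.1) pp.355–356; Balaban1987RG1, (0.1) p.251, (0.20) p.256] -/
theorem volumeFree_of_cor3With_datumOfRecord₁₃SepCoPH {γ b : ℝ} (hb : 0 < b) (hβ : BetaLowerH b γ (betaOfRecord₁₃ F N θ.toStage13Params)) {em ep : ℝ → ℝ}
    (hcor : B16.Cor3With (datumOfRecord₁₃SepCoPH F N θ h).C γ em ep) :
    ∀ P : B12.RunParams, ((datumOfRecord₁₃SepCoPH F N θ h).C P).flow.InInterval γ P.K → ∀ k, k ≤ P.K → ∀ V : GaugeField (F.P P.K) k (SU N),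
      ((datumOfRecord₁₃SepCoPH F N θ h).C P).χ k V *
            Real.exp (-(1 / (((datumOfRecord₁₃SepCoPH F N θ h).C P).flow.g k) ^ 2 * ((datumOfRecord₁₃SepCoPH F N θ h).C P).wilsonBG k V)
              - max (em (gOfRecord₁₃ F N θ.toStage13Params P k)) 0 *
                ((2 * (F.L : ℝ) ^ (F.m + ⌊((gOfRecord₁₃ F N θ.toStage13Params P k) ^ 2)⁻¹ / b⌋₊)) ^ 4)) ≤
          ((datumOfRecord₁₃SepCoPH F N θ h).C P).ρ k V ∧
        ((datumOfRecord₁₃SepCoPH F N θ h).C P).ρ k V ≤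
          Real.exp (max (ep (gOfRecord₁₃ F N θ.toStage13Params P k)) 0 *
            ((2 * (F.L : ℝ) ^ (F.m + ⌊((gOfRecord₁₃ F N θ.toStage13Params P k) ^ 2)⁻¹ / b⌋₊)) ^ 4)) := by
  intro P hP k hk V
  obtain ⟨hlow, hup⟩ := hcor P hP k hk V
  have hχ : 0 ≤ ((datumOfRecord₁₃SepCoPH F N θ h).C P).χ k V := (chiFix29OfRecord_mem_Icc θ.ν θ.ε₂₉ P.K k V).1
  have hnum := numSites_datumOfRecord₁₃SepCoPH_le_of_betaLowerH θ h hb hβ P hP hk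
  have hT : (((datumOfRecord₁₃SepCoPH F N θ h).C P).numSites k : ℝ) ≤
      (2 * (F.L : ℝ) ^ (F.m + ⌊((gOfRecord₁₃ F N θ.toStage13Params P k) ^ 2)⁻¹ / b⌋₊)) ^ 4 := by
    exact_mod_cast hnum
  have hT0 : (0 : ℝ) ≤ (((datumOfRecord₁₃SepCoPH F N θ h).C P).numSites k : ℝ) := Nat.cast_nonneg _
  set g := gOfRecord₁₃ F N θ.toStage13Params P k with hg
  set Vol : ℝ := (2 * (F.L : ℝ) ^ (F.m + ⌊(g ^ 2)⁻¹ / b⌋₊)) ^ 4 with hVol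
  -- `e·|T| ≤ max(e,0)·|T| ≤ max(e,0)·Vol`
  have hm : em g * (((datumOfRecord₁₃SepCoPH F N θ h).C P).numSites k : ℝ) ≤ max (em g) 0 * Vol :=
    (mul_le_mul_of_nonneg_right (le_max_left _ _) hT0).trans (mul_le_mul_of_nonneg_left hT (le_max_right _ _))
  have hp : ep g * (((datumOfRecord₁₃SepCoPH F N θ h).C P).numSites k : ℝ) ≤ max (ep g) 0 * Vol :=
    (mul_le_mul_of_nonneg_right (le_max_left _ _) hT0).trans (mul_le_mul_of_nonneg_left hT (le_max_right _ _))
  have hgk : ((datumOfRecord₁₃SepCoPH F N θ h).C P).flow.g k = g := rfl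
  rw [hgk] at hlow hup ⊢
  refine ⟨le_trans (mul_le_mul_of_nonneg_left (Real.exp_le_exp.mpr (by linarith)) hχ) hlow, hup.trans (Real.exp_le_exp.mpr hp)⟩

end Record

end Summit.QuantumFields.YangMills.BalabanUVNodes.N13UVRowDepthIndexedAtRecord13

end
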